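import Mathlib
import HarnessLib
import Summits.HubbardSuperconductivity.HubbardSuperconductivity.Theorems.KLProgrammeKLRegimeEnginePairTransferOutClassGainBar

/-!
# Route `KLProgramme` — ENGINE item stmt-HubbardSuperconductivity-20437 `KLRegimeEngineV17F2`, stub (c) value lane, «(c)-OUT» brick (M3a′): THE `phGain` PLATEAU —
# `klEngGeo11.phGain m ρ ≥ 2²⁸` whenever `Λₘ·2⁻²⁴ ≤ ρ ≤ 2²⁴·Λₘ`, at EVERY scale — and the out-of-class increment against the full `gainBar` OFF the two
# forward windows `|p_{x−y}|_𝕋 < Λₙ₊₁·2⁻²⁴`, `|p_{x+y−Qm}|_𝕋 < Λₙ₊₁·2⁻²⁴` (cell gate-hubbard-kl, seat hubbard-kl-k3c2-p2 g18; sharpens the located «(c)-OUT-PH-FLAT»,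
# HOME/hubbard-kl-k3c2-p2/OUT-OF-CLASS-E2.md §5)

WHY.  `klEngGeo5.phGain n ρ = 2²⁸·min{1, min{BELOW(ρ), ABOVE(ρ)}}` (`klg5_phGain_eq`) with `BELOW(ρ) = 2²⁴·4⁻ⁿ + 2²⁴·ρ/klE0·4ⁿ ≥ 1` as soon as `ρ ≥ Λₙ·2⁻²⁴` and
`ABOVE(ρ) = 2²⁴Λₙ/ρ + 2²⁴√klE0·2⁻ⁿ ≥ 1` as long as `ρ ≤ 2²⁴Λₙ`: on that PLATEAU the slot is the flat `2²⁸` at EVERY scale, so the sign-blind member masses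
(`Wd/Wx_member_row_flat_le ≤ 2048·15367 < 2²⁵`) book there too — not only at the shallow scales of `…OutClassGainBar` §1.  Above the plateau the two-shell tails
take over (`…OutClassGainBar` §2, threshold `Λₙ₊₁/(8G) ≤ 2²⁴Λₙ₊₁`); BELOW it — the two FORWARD WINDOWS of torus width `Λₙ₊₁·2⁻²⁴` around `x = y` and `x + y = Qm` —
is the only place where «(c)-OUT-PH-FLAT» bites (signed rows + the kernel-flatness input of «(E4)-DRESSED-MOMENTS»).
* §1 `klg5_phGain_eq_two_pow_28_of_plateau`, **`two_pow_28_le_klEngGeo11_phGain_of_plateau`** (lift along `G5 = G6 = G7 = G8 ≤ G9 = G10 ≤ G11`),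
  `flat_mul_le_phGain_klEngGeo11_of_plateau`, `Wd/Wx_member_row_flat_le_phGain_klEngGeo11_of_plateau` (any `n`; `FrameOK`, `klBetaMin ≤ β ≤ L`, `0 ≤ Mq ≤ 2³(Klam U)²`);
* §2 **`outClass_increment_le_gainBar_offForward`** — `n ≤ n_β`, `Qm` out of the pair class at `n+1`, both leg transfers `≥ Λₙ₊₁·2⁻²⁴`, `M4² ≤ 2³(Klam U)²`,
  `M4²G² ≤ 2³²(Klam U)²`: `‖A_j(1) − A_j(0)‖(x,y) ≤ (Λₙ−Λₙ₊₁)·½RH + 2·B6 + RL + gainBar klEngGeo11 P U (n+1) |p_Qm|_𝕋 |p_{x−y}|_𝕋 |p_{x+y−Qm}|_𝕋`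
  (`n = 0`: `outClass_increment_le_gainBar_shallow`; `n ≥ 1`: per leg, plateau-flat for `ρ ≤ 2²⁴Λₙ₊₁`, `Wd/Wx_member_row_le_phGain_klEngGeo11` above).
Composition/arithmetic over landed rows; nothing about the model's sizes is asserted; nothing asserts (E2″-F), (c), K3 or superconductivity.  0 kit · 0 lit.
-/

noncomputable section

namespace Summit.HubbardSuperconductivity.HubbardSuperconductivity.Theorems.KLRegimeSplit

set_option linter.dupNamespace false -- summit = problem name (single-conjunct summit), D-0017

open Finset Matrix Set Literature.MathematicalPhysics.QuantumLattice Literature.Probability.LatticeModels GrassmannAlgebra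
open Summit.HubbardSuperconductivity.HubbardSuperconductivity.Theorems.KLProgrammeLegKernels
open Summit.HubbardSuperconductivity.HubbardSuperconductivity.Theorems.TwoPointAssembly
open Summit.HubbardSuperconductivity.HubbardSuperconductivity.Theorems.DispersionFlow
open Summit.HubbardSuperconductivity.HubbardSuperconductivity.Theorems.KLRegimeWick
open Summit.HubbardSuperconductivity.HubbardSuperconductivity.Theorems.EngineV8

/-! ## §1 The plateau of the particle–hole slot and the flat member bookings on it -/

/-- **The plateau at `klEngGeo5`**: `Λₙ·2⁻²⁴ ≤ ρ ≤ 2²⁴·Λₙ ⇒ klEngGeo5.phGain n ρ = 2²⁸`. -/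
theorem klg5_phGain_eq_two_pow_28_of_plateau {n : ℕ} {ρ : ℝ} (hlo : klScale klE0 n * (2 ^ 24)⁻¹ ≤ ρ) (hhi : ρ ≤ 2 ^ 24 * klScale klE0 n) :
    klEngGeo5.phGain n ρ = 2 ^ 28 := by
  have hΛ : 0 < klScale klE0 n := klth_klScale_pos n
  have hρ : 0 < ρ := lt_of_lt_of_le (by positivity) hlo
  have hE0 : (0 : ℝ) < klE0 := by unfold klE0; norm_num
  have h4 : 0 < (4 : ℝ) ^ n := by positivity
  rw [klg5_phGain_eq hρ.le n, if_pos hρ]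
  have hsc : klScale klE0 n = klE0 * ((4 : ℝ) ^ n)⁻¹ := rfl
  have hX : 1 ≤ 2 ^ 24 * ((4 : ℝ) ^ n)⁻¹ + 2 ^ 24 * ρ / klE0 * (4 : ℝ) ^ n := by
    have key : klScale klE0 n * (2 ^ 24)⁻¹ * (2 ^ 24 * (4 : ℝ) ^ n / klE0) = 1 := by
      rw [hsc]; field_simp
    have h1 : 1 ≤ 2 ^ 24 * ρ / klE0 * (4 : ℝ) ^ n :=
      calc (1 : ℝ) = klScale klE0 n * (2 ^ 24)⁻¹ * (2 ^ 24 * (4 : ℝ) ^ n / klE0) := key.symm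
        _ ≤ ρ * (2 ^ 24 * (4 : ℝ) ^ n / klE0) := mul_le_mul_of_nonneg_right hlo (by positivity)
        _ = 2 ^ 24 * ρ / klE0 * (4 : ℝ) ^ n := by ring
    have h2 : 0 ≤ 2 ^ 24 * ((4 : ℝ) ^ n)⁻¹ := by positivity
    linarith
  have hY : 1 ≤ 2 ^ 24 * (klE0 * ((4 : ℝ) ^ n)⁻¹) / ρ + 2 ^ 24 * Real.sqrt klE0 * ((2 : ℝ) ^ n)⁻¹ := by
    have h1 : 1 ≤ 2 ^ 24 * (klE0 * ((4 : ℝ) ^ n)⁻¹) / ρ := by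
      rw [one_le_div hρ, ← hsc]; exact hhi
    have h2 : 0 ≤ 2 ^ 24 * Real.sqrt klE0 * ((2 : ℝ) ^ n)⁻¹ := by positivity
    linarith
  rw [min_eq_left (le_min hX hY), mul_one]

/-- **The plateau at the token**: `Λₘ·2⁻²⁴ ≤ ρ ≤ 2²⁴·Λₘ ⇒ 2²⁸ ≤ klEngGeo11.phGain m ρ` (every scale `m`). -/
theorem two_pow_28_le_klEngGeo11_phGain_of_plateau {m : ℕ} {ρ : ℝ} (hlo : klScale klE0 m * (2 ^ 24)⁻¹ ≤ ρ) (hhi : ρ ≤ 2 ^ 24 * klScale klE0 m) :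
    (2 : ℝ) ^ 28 ≤ klEngGeo11.phGain m ρ := by
  have h10 := klEngGeo10_phGain_le_klEngGeo11_phGain m ρ
  rw [klEngGeo10_phGain] at h10
  have h89 := klEngGeo8_phGain_le_klEngGeo9_phGain m ρ
  rw [klEngGeo8_phGain, klEngGeo7_phGain, klEngGeo6_phGain, klg5_phGain_eq_two_pow_28_of_plateau hlo hhi] at h89
  linarith

/-- Plateau flat booking arithmetic: `W ≤ 2048·15367`, `0 ≤ Mq ≤ 2³·Kl²`, plateau ⇒ `Mq·W ≤ Kl²·klEngGeo11.phGain m ρ`. -/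
theorem flat_mul_le_phGain_klEngGeo11_of_plateau {Mq W Kl : ℝ} (hW : W ≤ 2048 * 15367) (hMq : 0 ≤ Mq) (hM : Mq ≤ 2 ^ 3 * Kl ^ 2) {m : ℕ} {ρ : ℝ}
    (hlo : klScale klE0 m * (2 ^ 24)⁻¹ ≤ ρ) (hhi : ρ ≤ 2 ^ 24 * klScale klE0 m) :
    Mq * W ≤ Kl ^ 2 * klEngGeo11.phGain m ρ := by
  have h := two_pow_28_le_klEngGeo11_phGain_of_plateau hlo hhi
  have h1 : Mq * W ≤ Mq * (2048 * 15367) := mul_le_mul_of_nonneg_left hW hMq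
  have h2 : Mq * (2048 * 15367) ≤ 2 ^ 3 * Kl ^ 2 * (2048 * 15367) := mul_le_mul_of_nonneg_right hM (by norm_num)
  nlinarith [sq_nonneg Kl]


section Flat

variable {L M : ℕ} [NeZero L] [NeZero M] (β μ : ℝ) (K : TrigPolyC4v) {R : RenConsts} {U : ℝ} {N : ℕ}

/-- **DIRECT member ph mass, FLAT booking on the plateau** (any scale; `FrameOK`, `klBetaMin ≤ β ≤ L`; `0 ≤ Mq ≤ 2³(Klam U)²`; `Λₙ₊₁2⁻²⁴ ≤ ρ ≤ 2²⁴Λₙ₊₁`). -/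
theorem Wd_member_row_flat_le_phGain_klEngGeo11_of_plateau (hK : FrameOK R U N μ K) (hβm : klBetaMin ≤ β) (hβL : β ≤ L) (n : ℕ) {j : ℕ} (hj : n + 1 ≤ j)
    {t : ℝ} (ht : t ∈ Icc (0 : ℝ) 1) (x y : TorusSite 2 L) {P : SplitConsts} {Mq : ℝ} (hMq : 0 ≤ Mq) (hM : Mq ≤ 2 ^ 3 * (P.Klam * U) ^ 2)
    {ρ : ℝ} (hρlo : klScale klE0 (n + 1) * (2 ^ 24)⁻¹ ≤ ρ) (hρhi : ρ ≤ 2 ^ 24 * klScale klE0 (n + 1)) :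
    Mq * ((klScale klE0 n - klScale klE0 (n + 1)) * ((β * (L : ℝ) ^ 2) ^ 3)⁻¹ *
      ∑ p : FreqMomentum L M, ∑ _σ : Fin 2, ∑ p' : FreqMomentum L M,
        (if matsubaraInt M p'.1 + matsubaraInt M (omega0 M) = matsubaraInt M p.1 + matsubaraInt M (omega0 M) ∧ p'.2 = p.2 + x - y then
          ‖((((softSymbolCompl L M β μ K (n + 1) j p + (hubbardCutoffWeightCT L M β μ K (klScale klE0 (n + 1)) p -
                hubbardCutoffWeightCT L M β μ K (klScale klE0 n + t * (klScale klE0 (n + 1) - klScale klE0 n)) p) : ℝ)) : ℂ) *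
                (((β * (L : ℝ) ^ 2 : ℝ) : ℂ) * propCT L M β μ K p)) *
              ((((deriv (fun Λ' : ℝ => hubbardCutoffWeightCT L M β μ K Λ' p') (klScale klE0 n + t * (klScale klE0 (n + 1) - klScale klE0 n)) : ℝ)) : ℂ) *
                (((β * (L : ℝ) ^ 2 : ℝ) : ℂ) * propCT L M β μ K p')) +
            ((((deriv (fun Λ' : ℝ => hubbardCutoffWeightCT L M β μ K Λ' p) (klScale klE0 n + t * (klScale klE0 (n + 1) - klScale klE0 n)) : ℝ)) : ℂ) *
                (((β * (L : ℝ) ^ 2 : ℝ) : ℂ) * propCT L M β μ K p)) *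
              ((((softSymbolCompl L M β μ K (n + 1) j p' + (hubbardCutoffWeightCT L M β μ K (klScale klE0 (n + 1)) p' -
                hubbardCutoffWeightCT L M β μ K (klScale klE0 n + t * (klScale klE0 (n + 1) - klScale klE0 n)) p') : ℝ)) : ℂ) *
                (((β * (L : ℝ) ^ 2 : ℝ) : ℂ) * propCT L M β μ K p'))‖
        else 0)) ≤
      (P.Klam * U) ^ 2 * klEngGeo11.phGain (n + 1) ρ :=
  flat_mul_le_phGain_klEngGeo11_of_plateau (Wd_member_row_flat_le β μ K hK hβm hβL n hj ht x y) hMq hM hρlo hρhi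

/-- **CROSSED member ph mass, FLAT booking on the plateau** (as `Wd_member_row_flat_le_phGain_klEngGeo11_of_plateau`). -/
theorem Wx_member_row_flat_le_phGain_klEngGeo11_of_plateau (hK : FrameOK R U N μ K) (hβm : klBetaMin ≤ β) (hβL : β ≤ L) (n : ℕ) {j : ℕ} (hj : n + 1 ≤ j)
    {t : ℝ} (ht : t ∈ Icc (0 : ℝ) 1) (Qm x y : TorusSite 2 L) {P : SplitConsts} {Mq : ℝ} (hMq : 0 ≤ Mq)
    (hM : Mq ≤ 2 ^ 3 * (P.Klam * U) ^ 2) {ρ : ℝ} (hρlo : klScale klE0 (n + 1) * (2 ^ 24)⁻¹ ≤ ρ) (hρhi : ρ ≤ 2 ^ 24 * klScale klE0 (n + 1)) :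
    Mq * ((klScale klE0 n - klScale klE0 (n + 1)) * ((β * (L : ℝ) ^ 2) ^ 3)⁻¹ *
      ∑ p : FreqMomentum L M, ∑ p' : FreqMomentum L M,
        (if matsubaraInt M p'.1 + matsubaraInt M (omega0 M) + matsubaraInt M (omega0 M) + 1 = matsubaraInt M p.1 ∧ p'.2 = p.2 + Qm - x - y then
          ‖((((softSymbolCompl L M β μ K (n + 1) j p + (hubbardCutoffWeightCT L M β μ K (klScale klE0 (n + 1)) p -
                hubbardCutoffWeightCT L M β μ K (klScale klE0 n + t * (klScale klE0 (n + 1) - klScale klE0 n)) p) : ℝ)) : ℂ) *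
                (((β * (L : ℝ) ^ 2 : ℝ) : ℂ) * propCT L M β μ K p)) *
              ((((deriv (fun Λ' : ℝ => hubbardCutoffWeightCT L M β μ K Λ' p') (klScale klE0 n + t * (klScale klE0 (n + 1) - klScale klE0 n)) : ℝ)) : ℂ) *
                (((β * (L : ℝ) ^ 2 : ℝ) : ℂ) * propCT L M β μ K p')) +
            ((((deriv (fun Λ' : ℝ => hubbardCutoffWeightCT L M β μ K Λ' p) (klScale klE0 n + t * (klScale klE0 (n + 1) - klScale klE0 n)) : ℝ)) : ℂ) *
                (((β * (L : ℝ) ^ 2 : ℝ) : ℂ) * propCT L M β μ K p)) *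
              ((((softSymbolCompl L M β μ K (n + 1) j p' + (hubbardCutoffWeightCT L M β μ K (klScale klE0 (n + 1)) p' -
                hubbardCutoffWeightCT L M β μ K (klScale klE0 n + t * (klScale klE0 (n + 1) - klScale klE0 n)) p') : ℝ)) : ℂ) *
                (((β * (L : ℝ) ^ 2 : ℝ) : ℂ) * propCT L M β μ K p'))‖
        else 0)) ≤
      (P.Klam * U) ^ 2 * klEngGeo11.phGain (n + 1) ρ :=
  flat_mul_le_phGain_klEngGeo11_of_plateau ((Wx_member_row_flat_le β μ K hK hβm hβL n hj ht Qm x y).trans (by norm_num)) hMq hM hρlo hρhi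

end Flat

/-! ## §2 The out-of-class increment against the full `gainBar` off the two forward windows -/

section Assembly

variable (L M : ℕ) [NeZero L] [NeZero M] (β U μ : ℝ) (K : TrigPolyC4v) {R : RenConsts} {N : ℕ}

/-- **OUT-OF-CLASS INCREMENT vs `gainBar`, OFF THE FORWARD WINDOWS** (module docstring §2). -/
theorem outClass_increment_le_gainBar_offForward (hR : R.WF2) (hU : 0 < U) (hUu : U ≤ klTSU R) (hμ : μ ∈ klWindowC)
    (hK : FrameOK R U N μ K) (hβ : klBetaMin ≤ β) (hβL : β ≤ L) {n : ℕ} (hn : n ≤ nScales β)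
    (hGL : 8 * (4 + 8 / 3 * R.Gfr 1 * U ^ 2) * β ≤ L)
    (A A' : ℕ → TorusSite 2 L → ℝ → Matrix (TorusSite 2 L) (TorusSite 2 L) ℂ) (b' : ℕ → TorusSite 2 L → ℝ → TorusSite 2 L → ℂ)
    (hAdef : A = fun j Qm t => Matrix.of fun k k' : TorusSite 2 L => if k ∈ klBall L μ 0 ∧ k' ∈ klBall L μ 0 then
      vertexFn L M β (gaussConv ℂ (softCovOf L M β μ K (softSymbolCompl L M β μ K (n + 1) j) + hubbardCovAboveCT L M β μ 0 K (klScale klE0 (n + 1)) - hubbardCovAboveCT L M β μ 0 K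
              (klScale klE0 n + t * (klScale klE0 (n + 1) - klScale klE0 n))) (hubbardEffectiveActionCT L M β U μ 0 K (klScale klE0 n + t * (klScale klE0 (n + 1) - klScale klE0 n)))) 4
              ![(((omega0 M, k'), 0), 0), ((((omega0 M).rev, Qm - k'), 1), 0), ((((omega0 M).rev, Qm - k), 1), 1), (((omega0 M, k), 0), 1)]
      else 0)
    (hA'def : A' = fun j Qm t => Matrix.of fun k k' : TorusSite 2 L => if k ∈ klBall L μ 0 ∧ k' ∈ klBall L μ 0 then
      (klScale klE0 (n + 1) - klScale klE0 n) • -((2 : ℂ)⁻¹ * vertexFn L M β (gaussConv ℂ (softCovOf L M β μ K (softSymbolCompl L M β μ K (n + 1) j) + hubbardCovAboveCT L M β μ 0 K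
              (klScale klE0 (n + 1)) - hubbardCovAboveCT L M β μ 0 K (klScale klE0 n + t * (klScale klE0 (n + 1) - klScale klE0 n))) (grassmannDerivPairing ℂ (Matrix.of fun X Y :
              HubbardFieldIdx L M => deriv (fun Λ'' : ℝ => hubbardCovAboveCT L M β μ 0 K Λ'' X Y) (klScale klE0 n + t * (klScale klE0 (n + 1) - klScale klE0 n)))
              (hubbardEffectiveActionCT L M β U μ 0 K (klScale klE0 n + t * (klScale klE0 (n + 1) - klScale klE0 n))) (hubbardEffectiveActionCT L M β U μ 0 K (klScale klE0 n + t *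
              (klScale klE0 (n + 1) - klScale klE0 n))))) 4 ![(((omega0 M, k'), 0), 0), ((((omega0 M).rev, Qm - k'), 1), 0), ((((omega0 M).rev, Qm - k), 1), 1), (((omega0 M, k), 0),
              1)])
      else 0)
    (hb'def : b' = fun (j : ℕ) (Qm : TorusSite 2 L) (t : ℝ) (p : TorusSite 2 L) => (((klScale klE0 (n + 1) - klScale klE0 n) *
        (klBubbleMass L M β μ K (fun k => deriv (fun Λ' => hubbardCutoffWeightCT L M β μ K Λ' k) (klScale klE0 n + t * (klScale klE0 (n + 1) - klScale klE0 n))) (fun k =>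
                (softSymbolCompl L M β μ K (n + 1) j) k + (hubbardCutoffWeightCT L M β μ K (klScale klE0 (n + 1)) k - hubbardCutoffWeightCT L M β μ K (klScale klE0 n + t * (klScale
                klE0 (n + 1) - klScale klE0 n)) k)) Qm p +
          klBubbleMass L M β μ K (fun k => (softSymbolCompl L M β μ K (n + 1) j) k + (hubbardCutoffWeightCT L M β μ K (klScale klE0 (n + 1)) k - hubbardCutoffWeightCT L M β μ K
                  (klScale klE0 n + t * (klScale klE0 (n + 1) - klScale klE0 n)) k)) (fun k => deriv (fun Λ' => hubbardCutoffWeightCT L M β μ K Λ' k) (klScale klE0 n + t * (klScale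
                  klE0 (n + 1) - klScale klE0 n))) Qm p) : ℝ) : ℂ))
    (V : ℕ → ℝ → (Fin 4 → HubbardFieldIdx L M) → ℂ) (hV : V = fun j t X => vertexFn L M β (gaussConv ℂ (softCovOf L M β μ K (softSymbolCompl L M β μ K (n + 1) j) + hubbardCovAboveCT L
            M β μ 0 K (klScale klE0 (n + 1)) - hubbardCovAboveCT L M β μ 0 K (klScale klE0 n + t * (klScale klE0 (n + 1) - klScale klE0 n))) (hubbardEffectiveActionCT L M β U μ 0 K
            (klScale klE0 n + t * (klScale klE0 (n + 1) - klScale klE0 n)))) 4 X)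
    (V6 : ℕ → ℝ → (Fin 6 → HubbardFieldIdx L M) → ℂ) (hV6 : V6 = fun j t X => vertexFn L M β (gaussConv ℂ (softCovOf L M β μ K (softSymbolCompl L M β μ K (n + 1) j) + hubbardCovAboveCT
            L M β μ 0 K (klScale klE0 (n + 1)) - hubbardCovAboveCT L M β μ 0 K (klScale klE0 n + t * (klScale klE0 (n + 1) - klScale klE0 n))) (hubbardEffectiveActionCT L M β U μ 0 K
            (klScale klE0 n + t * (klScale klE0 (n + 1) - klScale klE0 n)))) 6 X)
    (Sg : ℕ → ℝ → FreqMomentum L M → Fin 2 → ℂ) (hSg : Sg = fun j t p σ => selfEnergy L M β (gaussConv ℂ (softCovOf L M β μ K (softSymbolCompl L M β μ K (n + 1) j) + hubbardCovAboveCT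
            L M β μ 0 K (klScale klE0 (n + 1)) - hubbardCovAboveCT L M β μ 0 K (klScale klE0 n + t * (klScale klE0 (n + 1) - klScale klE0 n))) (hubbardEffectiveActionCT L M β U μ 0 K
            (klScale klE0 n + t * (klScale klE0 (n + 1) - klScale klE0 n)))) p σ)
    (Hd : ℕ → ℝ → (Fin 4 → HubbardFieldIdx L M) → ℂ) (hHd : Hd = fun j t X => vertexFn L M β (dblFold ℂ (grassmannLaplacian ℂ (crossCov ℂ (Matrix.of fun X Y : HubbardFieldIdx L M =>
            deriv (fun Λ' : ℝ => hubbardCovAboveCT L M β μ 0 K Λ' X Y) (klScale klE0 n + t * (klScale klE0 (n + 1) - klScale klE0 n)))) ((gaussConv ℂ (crossCov ℂ (softCovOf L M β μ K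
            (softSymbolCompl L M β μ K (n + 1) j) + hubbardCovAboveCT L M β μ 0 K (klScale klE0 (n + 1)) - hubbardCovAboveCT L M β μ 0 K (klScale klE0 n + t * (klScale klE0 (n + 1) -
            klScale klE0 n)))) - grassmannLaplacian ℂ (crossCov ℂ (softCovOf L M β μ K (softSymbolCompl L M β μ K (n + 1) j) + hubbardCovAboveCT L M β μ 0 K (klScale klE0 (n + 1)) -
            hubbardCovAboveCT L M β μ 0 K (klScale klE0 n + t * (klScale klE0 (n + 1) - klScale klE0 n))))) (dblCopy ℂ 0 (gaussConv ℂ (softCovOf L M β μ K (softSymbolCompl L M β μ K (n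
            + 1) j) + hubbardCovAboveCT L M β μ 0 K (klScale klE0 (n + 1)) - hubbardCovAboveCT L M β μ 0 K (klScale klE0 n + t * (klScale klE0 (n + 1) - klScale klE0 n)))
            (hubbardEffectiveActionCT L M β U μ 0 K (klScale klE0 n + t * (klScale klE0 (n + 1) - klScale klE0 n)))) * dblCopy ℂ 1 (gaussConv ℂ (softCovOf L M β μ K (softSymbolCompl L
            M β μ K (n + 1) j) + hubbardCovAboveCT L M β μ 0 K (klScale klE0 (n + 1)) - hubbardCovAboveCT L M β μ 0 K (klScale klE0 n + t * (klScale klE0 (n + 1) - klScale klE0 n)))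
            (hubbardEffectiveActionCT L M β U μ 0 K (klScale klE0 n + t * (klScale klE0 (n + 1) - klScale klE0 n)))))))) 4 X)
    (Φ : ℕ → ℝ → FreqMomentum L M → ℝ) (hΦ : Φ = fun j t k => (softSymbolCompl L M β μ K (n + 1) j) k + (hubbardCutoffWeightCT L M β μ K (klScale klE0 (n + 1)) k -
            hubbardCutoffWeightCT L M β μ K (klScale klE0 n + t * (klScale klE0 (n + 1) - klScale klE0 n)) k))
    (Wd : ℝ → FreqMomentum L M → ℝ) (hWd : Wd = fun t k => deriv (fun Λ' : ℝ => hubbardCutoffWeightCT L M β μ K Λ' k) (klScale klE0 n + t * (klScale klE0 (n + 1) - klScale klE0 n)))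
    (Br : ℕ → TorusSite 2 L → ℝ → TorusSite 2 L × MatsubaraIdx M → ℂ) (hBr : Br = fun j Qm t z => -(((((β * (L : ℝ) ^ 2 : ℝ) : ℂ)))⁻¹ * propCT L M β μ K (z.2, z.1) * propCT L M β μ K
            (z.2.rev, Qm - z.1)) *
      ((((klScale klE0 (n + 1) - klScale klE0 n) * (-Wd t (z.2, z.1) * Φ j t (z.2.rev, Qm - z.1) - Φ j t (z.2, z.1) * Wd t (z.2.rev, Qm - z.1))) : ℝ) : ℂ))
    (j : ℕ) (hj : n + 1 ≤ j) {Qm : TorusSite 2 L} (hQ : ¬ IsPairClassAt L Qm (n + 1))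
    (hZ : ∀ Λ ∈ Icc (klScale klE0 (n + 1)) (klScale klE0 n), hubbardEffPartitionFnCT L M β U μ 0 K Λ ≠ 0)
    {P : SplitConsts} {m : ℝ} (hm0 : 0 ≤ m) (hm : m ^ 2 ≤ 2 ^ 8 * (P.Klam * U) ^ 2) (hAm : ∀ t ∈ Icc (0 : ℝ) 1, ∀ x y, ‖A j Qm t x y‖ ≤ m)
    (x y : TorusSite 2 L) {M4 M6 M2 RH RL B6 : ℝ} (hM40 : 0 ≤ M4)
    (hM4 : ∀ t ∈ Icc (0 : ℝ) 1, ∀ X, ‖V j t X‖ ≤ M4) (hM6 : ∀ t ∈ Icc (0 : ℝ) 1, ∀ X, ‖V6 j t X‖ ≤ M6) (hM2 : ∀ t ∈ Icc (0 : ℝ) 1, ∀ p σ, ‖Sg j t p σ‖ ≤ M2)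
    (hH : ∀ t ∈ Icc (0 : ℝ) 1, ‖Hd j t ![(((omega0 M, y), 0), 0), ((((omega0 M).rev, Qm - y), 1), 0), ((((omega0 M).rev, Qm - x), 1), 1), (((omega0 M, x), 0), 1)]‖ ≤ RH)
    (hL : ∀ t ∈ Icc (0 : ℝ) 1, ‖∑ z : TorusSite 2 L × MatsubaraIdx M, Br j Qm t z *
          ((if z.1 ∈ klBall L μ 0 then
              V j t ![(((omega0 M, z.1), 0), 0), ((((omega0 M).rev, Qm - z.1), 1), 0), ((((omega0 M).rev, Qm - x), 1), 1), (((omega0 M, x), 0), 1)] *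
                V j t ![(((omega0 M, y), 0), 0), ((((omega0 M).rev, Qm - y), 1), 0), ((((omega0 M).rev, Qm - z.1), 1), 1), (((omega0 M, z.1), 0), 1)]
            else 0) -
            V j t ![(((z.2, z.1), 0), 0), (((z.2.rev, Qm - z.1), 1), 0), ((((omega0 M).rev, Qm - x), 1), 1), (((omega0 M, x), 0), 1)] *
              V j t ![(((omega0 M, y), 0), 0), ((((omega0 M).rev, Qm - y), 1), 0), (((z.2.rev, Qm - z.1), 1), 1), (((z.2, z.1), 0), 1)])‖ ≤ RL)
    (hd6 : ∀ t ∈ Icc (0 : ℝ) 1, M6 * M2 * ((klScale klE0 n - klScale klE0 (n + 1)) * ((β * (L : ℝ) ^ 2) ^ 3)⁻¹ *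
      (∑ p : FreqMomentum L M, ∑ _σ : Fin 2, ‖(((((Wd t p) : ℝ) : ℂ) * (((β * (L : ℝ) ^ 2 : ℝ) : ℂ) * propCT L M β μ K p)) * ((((Φ j t p) : ℝ) : ℂ) * (((β * (L : ℝ)
                  ^ 2 : ℝ) : ℂ) * propCT L M β μ K p)))‖)) ≤ B6)
    (hM4K : M4 * M4 ≤ 2 ^ 3 * (P.Klam * U) ^ 2) (hM4KG : M4 * M4 * (4 + 8 / 3 * R.Gfr 1 * U ^ 2) ^ 2 ≤ 2 ^ 32 * (P.Klam * U) ^ 2)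
    (hdw : klScale klE0 (n + 1) * (2 ^ 24)⁻¹ ≤ klTorusNorm L (x - y)) (hxw : klScale klE0 (n + 1) * (2 ^ 24)⁻¹ ≤ klTorusNorm L (x + y - Qm)) :
    ‖A j Qm 1 x y - A j Qm 0 x y‖ ≤
      (klScale klE0 n - klScale klE0 (n + 1)) * (2⁻¹ * RH) + 2 * B6 + RL +
        gainBar klEngGeo11 P U (n + 1) (klTorusNorm L Qm) (klTorusNorm L (x - y)) (klTorusNorm L (x + y - Qm)) := by
  rcases Nat.eq_zero_or_pos n with hn0 | hn1
  · subst hn0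
    exact outClass_increment_le_gainBar_shallow L M β U μ K hR hU hUu hμ hK hβ hβL hn (by norm_num) hGL A A' b' hAdef hA'def hb'def V hV V6 hV6 Sg hSg
      Hd hHd Φ hΦ Wd hWd Br hBr j hj hQ hZ hm0 hm hAm x y hM40 hM4 hM6 hM2 hH hL hd6 hM4K
  have hβ0 : 0 < β := pos_of_klBetaMin_le hβ
  have hMM : 0 ≤ M4 * M4 := mul_nonneg hM40 hM40
  have hGfr : 0 ≤ R.Gfr 1 := hR.wf.2.2 1
  have h83 : 0 ≤ 8 / 3 * R.Gfr 1 * U ^ 2 := by positivity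
  have hG4 : 4 ≤ 4 + 8 / 3 * R.Gfr 1 * U ^ 2 := by linarith
  have hΛ1 : 0 < klScale klE0 (n + 1) := klth_klScale_pos (n + 1)
  obtain ⟨hj'β, hGδ, hE0⟩ := tail_regime_readings (L := L) β hR hβ hn1 hn hGL
  -- above the plateau the tail threshold holds: `ρ > 2²⁴Λₙ₊₁ ⇒ Λₙ₊₁/8 ≤ G·ρ`
  have hthr : ∀ ρ : ℝ, 2 ^ 24 * klScale klE0 (n + 1) < ρ → klScale klE0 (n + 1) / 8 ≤ (4 + 8 / 3 * R.Gfr 1 * U ^ 2) * ρ := fun ρ hρ => by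
    have hρ0 : 0 ≤ ρ := by linarith [hΛ1.le]
    nlinarith
  have hdd : ∀ t ∈ Icc (0 : ℝ) 1, M4 * M4 * ((klScale klE0 n - klScale klE0 (n + 1)) * ((β * (L : ℝ) ^ 2) ^ 3)⁻¹ *
      (∑ p : FreqMomentum L M, ∑ _σ : Fin 2, ∑ p' : FreqMomentum L M,
            if matsubaraInt M p'.1 + matsubaraInt M (omega0 M) = matsubaraInt M p.1 + matsubaraInt M (omega0 M) ∧ p'.2 = p.2 + x - y then ‖((((((Φ j t p) : ℝ) : ℂ) * (((β * (L : ℝ) ^ 2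
                    : ℝ) : ℂ) * propCT L M β μ K p)) * ((((Wd t p') : ℝ) : ℂ) * (((β * (L : ℝ) ^ 2 : ℝ) : ℂ) * propCT L M β μ K p'))) + (((((Wd t p) : ℝ) : ℂ) * (((β * (L : ℝ) ^ 2 : ℝ)
                    : ℂ) * propCT L M β μ K p)) * ((((Φ j t p') : ℝ) : ℂ) * (((β * (L : ℝ) ^ 2 : ℝ) : ℂ) * propCT L M β μ K p'))))‖ else 0)) ≤ (P.Klam * U) ^ 2 * klEngGeo11.phGain (n + 1) (klTorusNorm L (x - y)) := by
    intro t ht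
    rcases le_or_gt (klTorusNorm L (x - y)) (2 ^ 24 * klScale klE0 (n + 1)) with hle | hgt
    · subst hΦ hWd
      exact Wd_member_row_flat_le_phGain_klEngGeo11_of_plateau β μ K hK hβ hβL n hj ht x y hMM hM4K hdw hle
    · subst hΦ hWd
      exact Wd_member_row_le_phGain_klEngGeo11 β μ K hR hU hUu hμ hK hβ0 n hj hj'β ht hGδ hE0 hGL (hthr _ hgt) hMM hM4KG
  have hdx : ∀ t ∈ Icc (0 : ℝ) 1, M4 * M4 * ((klScale klE0 n - klScale klE0 (n + 1)) * ((β * (L : ℝ) ^ 2) ^ 3)⁻¹ *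
      (∑ p : FreqMomentum L M, ∑ p' : FreqMomentum L M,
            if matsubaraInt M p'.1 + matsubaraInt M (omega0 M) + matsubaraInt M (omega0 M) + 1 = matsubaraInt M p.1 ∧ p'.2 = p.2 + Qm - x - y then ‖((((((Φ j t p) : ℝ) : ℂ) * (((β * (L
                    : ℝ) ^ 2 : ℝ) : ℂ) * propCT L M β μ K p)) * ((((Wd t p') : ℝ) : ℂ) * (((β * (L : ℝ) ^ 2 : ℝ) : ℂ) * propCT L M β μ K p'))) + (((((Wd t p) : ℝ) : ℂ) * (((β * (L : ℝ)
                    ^ 2 : ℝ) : ℂ) * propCT L M β μ K p)) * ((((Φ j t p') : ℝ) : ℂ) * (((β * (L : ℝ) ^ 2 : ℝ) : ℂ) * propCT L M β μ K p'))))‖ else 0)) ≤ (P.Klam * U) ^ 2 * klEngGeo11.phGain (n + 1) (klTorusNorm L (x + y - Qm)) := by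
    intro t ht
    rcases le_or_gt (klTorusNorm L (x + y - Qm)) (2 ^ 24 * klScale klE0 (n + 1)) with hle | hgt
    · subst hΦ hWd
      exact Wx_member_row_flat_le_phGain_klEngGeo11_of_plateau β μ K hK hβ hβL n hj ht Qm x y hMM hM4K hxw hle
    · subst hΦ hWd
      exact Wx_member_row_le_phGain_klEngGeo11 β μ K hR hU hUu hμ hK hβ0 n hj hj'β ht hGδ hE0 hGL (hthr _ hgt) hMM hM4KG
  -- the masses door, pointwise in `t`
  have hS : ∀ t ∈ Icc (0 : ℝ) 1, ‖(A' j Qm t + A j Qm t * diagonal (b' j Qm t) * A j Qm t) x y‖ ≤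
      (klScale klE0 n - klScale klE0 (n + 1)) * (2⁻¹ * RH + ((β * (L : ℝ) ^ 2) ^ 3)⁻¹ *
        (M4 * M4 * (∑ p : FreqMomentum L M, ∑ _σ : Fin 2, ∑ p' : FreqMomentum L M,
            if matsubaraInt M p'.1 + matsubaraInt M (omega0 M) = matsubaraInt M p.1 + matsubaraInt M (omega0 M) ∧ p'.2 = p.2 + x - y then ‖((((((Φ j t p) : ℝ) : ℂ) * (((β * (L : ℝ) ^ 2
                    : ℝ) : ℂ) * propCT L M β μ K p)) * ((((Wd t p') : ℝ) : ℂ) * (((β * (L : ℝ) ^ 2 : ℝ) : ℂ) * propCT L M β μ K p'))) + (((((Wd t p) : ℝ) : ℂ) * (((β * (L : ℝ) ^ 2 : ℝ)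
                    : ℂ) * propCT L M β μ K p)) * ((((Φ j t p') : ℝ) : ℂ) * (((β * (L : ℝ) ^ 2 : ℝ) : ℂ) * propCT L M β μ K p'))))‖ else 0) +
          M4 * M4 * (∑ p : FreqMomentum L M, ∑ p' : FreqMomentum L M,
            if matsubaraInt M p'.1 + matsubaraInt M (omega0 M) + matsubaraInt M (omega0 M) + 1 = matsubaraInt M p.1 ∧ p'.2 = p.2 + Qm - x - y then ‖((((((Φ j t p) : ℝ) : ℂ) * (((β * (L
                    : ℝ) ^ 2 : ℝ) : ℂ) * propCT L M β μ K p)) * ((((Wd t p') : ℝ) : ℂ) * (((β * (L : ℝ) ^ 2 : ℝ) : ℂ) * propCT L M β μ K p'))) + (((((Wd t p) : ℝ) : ℂ) * (((β * (L : ℝ)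
                    ^ 2 : ℝ) : ℂ) * propCT L M β μ K p)) * ((((Φ j t p') : ℝ) : ℂ) * (((β * (L : ℝ) ^ 2 : ℝ) : ℂ) * propCT L M β μ K p'))))‖ else 0) +
          2 * (M6 * M2 * (∑ p : FreqMomentum L M, ∑ _σ : Fin 2, ‖(((((Wd t p) : ℝ) : ℂ) * (((β * (L : ℝ) ^ 2 : ℝ) : ℂ) * propCT L M β μ K p)) * ((((Φ j t p) : ℝ) : ℂ) * (((β * (L : ℝ)
                  ^ 2 : ℝ) : ℂ) * propCT L M β μ K p)))‖)))) + RL := fun t ht =>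
    klmd_defect_le_masses_family L M β U μ K hβ0 n A A' b' hAdef hA'def hb'def V hV V6 hV6 Sg hSg Hd hHd Φ hΦ Wd hWd Br hBr j Qm ht x y hM40
      (hM4 t ht) (hM6 t ht) (hM2 t ht) (hH t ht) (hL t ht)
  have hpt : ∀ t ∈ Icc (0 : ℝ) 1, ‖(fun s => A' j Qm s + A j Qm s * diagonal (b' j Qm s) * A j Qm s) t x y‖ ≤
      (klScale klE0 n - klScale klE0 (n + 1)) * (2⁻¹ * RH) + (P.Klam * U) ^ 2 * klEngGeo11.phGain (n + 1) (klTorusNorm L (x - y)) +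
        (P.Klam * U) ^ 2 * klEngGeo11.phGain (n + 1) (klTorusNorm L (x + y - Qm)) + 2 * B6 + RL := fun t ht =>
    (hS t ht).trans (klmf_distrib_rows (hdd t ht) (hdx t ht) (hd6 t ht))
  have hint := integral_le_of_forall_le_Icc (fun t _ => norm_nonneg _) hpt
  have hinc := klmf_memberArray_increment_le_source_add_ppGain L M β U μ K hR hU hUu hμ hK hβ hβL hn hj hGL hQ hZ (A j Qm) (A' j Qm)
    (by subst hAdef; rfl) (by subst hA'def; rfl) (b' j Qm) (by subst hb'def; rfl)
    (fun s => A' j Qm s + A j Qm s * diagonal (b' j Qm s) * A j Qm s) (fun s _ => rfl) hm0 hm hAm x y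
  unfold gainBar
  linarith

end Assembly

end Summit.HubbardSuperconductivity.HubbardSuperconductivity.Theorems.KLRegimeSplit

end
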